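import Literature.NumberTheory.Transcendental.KZLogCalculusProofs

/-!
# Toric assembly, part A: classes of log-boxes and the power law

Helper file for the stub `stub_toricAssembly` of the line `Sketch` (card `log-polytope-hilbert-three`)
of the crux `VolumeFormOffPlane` (stmt-KontsevichZagierPeriods-14935), route `SymplecticScissors`.

We work in the quotient `KZ.FormalRep ⧸ KZ.relations` and record, under the hypotheses of the
stub (existence of log-box representations, the cut move, the diagonal scaling move — all stated
verbatim as in the registered stubs `stub_logBoxCut`, `stub_logBoxLinear`), the elementary
bookkeeping of ORIGIN LOG-BOXES `{1 < x_j < c_j, 0 < z, z ∏ x_j < 1}`: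
* the class of an integrand-`1` representation depends only on its domain;
* the POWER LAW: the class of the origin box with edge `(1, γ^k)` in coordinate `m` is `k` times
  the class of the origin box with edge `(1, γ)` there (cuts at `γ^i` and the scalings
  `x_m ↦ γ^{-i} x_m`).
-/

noncomputable section

open MeasureTheory Set
open Literature.NumberTheory.Transcendental

namespace Summit.KontsevichZagierPeriods.SymplecticScissors.LogPolytope

-- Shorthands used in the SOURCE of this file (work/toric/ToricA.src.lean, expanded by
-- work/toric/pp.py before checking/landing; the landed file is notation-free):
--   𝔅(n, a, b)  = the log-box {p : Fin (n+1) → ℝ | (∀ j, a j < p j.castSucc < b j) ∧ 0 < p last ∧ p last * ∏ p j.castSucc < 1}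
--   𝔅₁(n, c)    = 𝔅(n, fun _ => 1, c)            π = QuotientAddGroup.mk' KZ.relations
--   HExists / HCut / HScale / HPerm / HValue / HGS = the registered stub statements (verbatim).

/-! ## Classes of integrand-one representations -/

/-- Two integrand-`1` representations with the same domain have the same class
(rule 2 with `Φ = id`). [folklore] -/
theorem toric_mk_eq_of_domain_eq : ∀ {N : ℕ} {r r' : KZ.IntegralRep N}, r.domain = r'.domain → (∀ x ∈ r.domain, r.integrand x = 1) → (∀ x ∈ r'.domain, r'.integrand x = 1) → (QuotientAddGroup.mk' KZ.relations) (KZ.of r) = (QuotientAddGroup.mk' KZ.relations) (KZ.of r') := by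
  intro N r r' hd hr hr'
  rw [QuotientAddGroup.mk'_apply, QuotientAddGroup.mk'_apply, QuotientAddGroup.eq_iff_sub_mem]
  exact KZ.of_sub_of_mem_relations_of_eqOn hd.symm fun x hx => by
    rw [hr x hx, hr' x (hd ▸ hx)]

/-- An integrand representation over an empty domain has class `0`. [folklore] -/
theorem toric_mk_eq_zero_of_domain_eq_empty {N : ℕ} {r : KZ.IntegralRep N} (hd : r.domain = ∅) :
    (QuotientAddGroup.mk' KZ.relations) (KZ.of r) = 0 := by
  rw [QuotientAddGroup.mk'_apply, QuotientAddGroup.eq_zero_iff]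
  exact KZ.of_mem_relations_of_volume_eq_zero r (by rw [hd, measure_empty])

/-- Membership form of `of r - of r' ∈ relations` in the quotient. [folklore] -/
theorem toric_mk_eq_iff {c c' : KZ.FormalRep} : (QuotientAddGroup.mk' KZ.relations) c = (QuotientAddGroup.mk' KZ.relations) c' ↔ c - c' ∈ KZ.relations := by
  rw [QuotientAddGroup.mk'_apply, QuotientAddGroup.mk'_apply, QuotientAddGroup.eq_iff_sub_mem]

/-! ## Origin boxes: emptiness, cutting and scaling in one coordinate -/

/-- An origin log-box one of whose upper corners is `≤ 1` is empty. [folklore] -/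
theorem toric_box_eq_empty_of_le_one {n : ℕ} (c : Fin n → ℝ) (m : Fin n) (hm : c m ≤ 1) :
    {p : Fin (n + 1) → ℝ | (∀ j : Fin n, (fun _ => (1 : ℝ)) j < p (Fin.castSucc j) ∧ p (Fin.castSucc j) < c j) ∧ 0 < p (Fin.last n) ∧ p (Fin.last n) * ∏ j : Fin n, p (Fin.castSucc j) < 1} = ∅ := by
  ext p
  simp only [mem_setOf_eq, mem_empty_iff_false, iff_false, not_and]
  intro h
  have h1 := (h m).1
  have h2 := (h m).2
  exact absurd (h1.trans h2) (not_lt.mpr hm)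

/-- From a three-term relation to an equation of classes. [folklore] -/
theorem toric_mk_eq_add_of_sub_sub_mem {c c₁ c₂ : KZ.FormalRep} (h : c - c₁ - c₂ ∈ KZ.relations) :
    (QuotientAddGroup.mk' KZ.relations) c = (QuotientAddGroup.mk' KZ.relations) c₁ + (QuotientAddGroup.mk' KZ.relations) c₂ := by
  rw [← map_add, toric_mk_eq_iff]
  simpa [sub_sub] using h

/-- Updating an algebraic vector at one place by an algebraic number stays algebraic. [folklore] -/
theorem toric_update_algebraic {n : ℕ} {c : Fin n → ℝ} (hca : ∀ j, IsAlgebraic ℚ (c j)) (m : Fin n)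
    {x : ℝ} (hx : IsAlgebraic ℚ x) : ∀ j, IsAlgebraic ℚ (Function.update c m x j) := by
  intro j
  rcases eq_or_ne j m with rfl | h
  · simpa using hx
  · simpa [Function.update_of_ne h] using hca j

/-- Updating a positive vector at one place by a positive number stays positive. [folklore] -/
theorem toric_update_pos {n : ℕ} {c : Fin n → ℝ} (hc : ∀ j, 0 < c j) (m : Fin n)
    {x : ℝ} (hx : 0 < x) : ∀ j, 0 < Function.update c m x j := by
  intro j
  rcases eq_or_ne j m with rfl | h
  · simpa using hx
  · simpa [Function.update_of_ne h] using hc j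

/-- **Power law for origin log-boxes.** Under the existence, cut and scaling hypotheses: the
class of the origin box whose `m`-th edge is `(1, γ ^ k)` is `k` times the class of the origin
box whose `m`-th edge is `(1, γ)` (`γ > 1` real algebraic; the other edges `(1, c_j)`, `c_j`
real algebraic). Induction on `k`: cut at `x_m = γ ^ k` (rule 1a) and rescale the upper piece by
`x_m ↦ γ^{-k} x_m` (rule 2). [folklore] -/
theorem toric_pow (hEx : (∀ (n : ℕ) (a b : Fin n → ℝ), (∀ j, 0 < a j) → (∀ j, IsAlgebraic ℚ (a j)) → (∀ j, IsAlgebraic ℚ (b j)) → ∃ r : KZ.IntegralRep (n + 1), r.domain = {p : Fin (n + 1) → ℝ | (∀ j : Fin n, a j < p (Fin.castSucc j) ∧ p (Fin.castSucc j) < b j) ∧ 0 < p (Fin.last n) ∧ p (Fin.last n) * ∏ j : Fin n, p (Fin.castSucc j) < 1} ∧ r.integrand = fun _ => 1)) (hCut : (∀ (n : ℕ) (a b : Fin n → ℝ) (j : Fin n) (c : ℝ), IsAlgebraic ℚ c → a j ≤ c → c ≤ b j → ∀ (r r₁ r₂ : KZ.IntegralRep (n + 1)), r.domain = {p : Fin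 (n + 1) → ℝ | (∀ j : Fin n, a j < p (Fin.castSucc j) ∧ p (Fin.castSucc j) < b j) ∧ 0 < p (Fin.last n) ∧ p (Fin.last n) * ∏ j : Fin n, p (Fin.castSucc j) < 1} → r₁.domain = {p : Fin (n + 1) → ℝ | (∀ i : Fin n, a i < p (Fin.castSucc i) ∧ p (Fin.castSucc i) < Function.update b j c i) ∧ 0 < p (Fin.last n) ∧ p (Fin.last n) * ∏ i : Fin n, p (Fin.castSucc i) < 1} → r₂.domain = {p : Fin (n + 1) → ℝ | (∀ i : Fin n, Function.update a j c i < p (Fin.castSucc i) ∧ p (Fin.castSucc i) < b i) ∧ 0 < p (Fin.last n) ∧ p (Fin.last n) * ∏ i : Fin n, p (Fin.castSucc i) < 1} → (∀ p ∈ r.domain, r.integrand p = 1) → (∀ p ∈ r₁.domain, r₁.integrand p = 1) → (∀ p ∈ r₂.domain, r₂.integrand p = 1) → KZ.of r - KZ.of r₁ - KZ.of r₂ ∈ KZ.relations)) (hScale : (∀ (n : ℕ) (a b l : Fin n → ℝ), (∀ j, 0 < l j) → (∀ j, IsAlgebraic ℚ (l j)) → ∀ (r r' : KZ.IntegralRep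 (n + 1)), r.domain = {p : Fin (n + 1) → ℝ | (∀ j : Fin n, a j < p (Fin.castSucc j) ∧ p (Fin.castSucc j) < b j) ∧ 0 < p (Fin.last n) ∧ p (Fin.last n) * ∏ j : Fin n, p (Fin.castSucc j) < 1} → r'.domain = {p : Fin (n + 1) → ℝ | (∀ j : Fin n, l j * a j < p (Fin.castSucc j) ∧ p (Fin.castSucc j) < l j * b j) ∧ 0 < p (Fin.last n) ∧ p (Fin.last n) * ∏ j : Fin n, p (Fin.castSucc j) < 1} → (∀ p ∈ r.domain, r.integrand p = 1) → (∀ p ∈ r'.domain, r'.integrand p = 1) → KZ.of r - KZ.of r' ∈ KZ.relations)) {n : ℕ} (c : Fin n → ℝ)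
    (hca : ∀ j, IsAlgebraic ℚ (c j)) (m : Fin n) {γ : ℝ} (hγ : 1 < γ)
    (hγa : IsAlgebraic ℚ γ) (u : KZ.IntegralRep (n + 1))
    (hud : u.domain = {p : Fin (n + 1) → ℝ | (∀ j : Fin n, (fun _ => (1:ℝ)) j < p (Fin.castSucc j) ∧ p (Fin.castSucc j) < (Function.update c m γ) j) ∧ 0 < p (Fin.last n) ∧ p (Fin.last n) * ∏ j : Fin n, p (Fin.castSucc j) < 1})
    (hu : ∀ x ∈ u.domain, u.integrand x = 1) :
    ∀ (k : ℕ) (r : KZ.IntegralRep (n + 1)),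
      r.domain = {p : Fin (n + 1) → ℝ | (∀ j : Fin n, (fun _ => (1:ℝ)) j < p (Fin.castSucc j) ∧ p (Fin.castSucc j) < (Function.update c m (γ ^ k)) j) ∧ 0 < p (Fin.last n) ∧ p (Fin.last n) * ∏ j : Fin n, p (Fin.castSucc j) < 1} →
      (∀ x ∈ r.domain, r.integrand x = 1) → (QuotientAddGroup.mk' KZ.relations) (KZ.of r) = k • (QuotientAddGroup.mk' KZ.relations) (KZ.of u) := by
  intro k
  induction k with
  | zero =>
    intro r hrd _hr
    rw [zero_smul]
    apply toric_mk_eq_zero_of_domain_eq_empty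
    rw [hrd]
    exact toric_box_eq_empty_of_le_one _ m (by simp)
  | succ k ih =>
    intro r hrd hr
    have hγ0 : 0 < γ := one_pos.trans hγ
    have hγk0 : 0 < γ ^ k := pow_pos hγ0 k
    have h1a : ∀ j : Fin n, IsAlgebraic ℚ ((fun _ => (1:ℝ)) j) := fun _ => isAlgebraic_one
    have h1p : ∀ j : Fin n, 0 < (fun _ => (1:ℝ)) j := fun _ => one_pos
    -- the lower piece r₁ on 𝔅(1, c[m ↦ γ^(k+1)][m ↦ γ^k]) and the upper piece r₂
    obtain ⟨r₁, hr₁d, hr₁i⟩ := hEx n (fun _ => (1:ℝ))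
      (Function.update (Function.update c m (γ ^ (k + 1))) m (γ ^ k)) h1p h1a
      (toric_update_algebraic (toric_update_algebraic hca m (hγa.pow _)) m (hγa.pow _))
    obtain ⟨r₂, hr₂d, hr₂i⟩ := hEx n (Function.update (fun _ => (1:ℝ)) m (γ ^ k))
      (Function.update c m (γ ^ (k + 1))) (toric_update_pos h1p m hγk0)
      (toric_update_algebraic h1a m (hγa.pow _)) (toric_update_algebraic hca m (hγa.pow _))
    have hr₁i' : ∀ x ∈ r₁.domain, r₁.integrand x = 1 := fun x _ => by rw [hr₁i]
    have hr₂i' : ∀ x ∈ r₂.domain, r₂.integrand x = 1 := fun x _ => by rw [hr₂i]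
    have hcut := hCut n (fun _ => (1:ℝ)) (Function.update c m (γ ^ (k + 1))) m (γ ^ k)
      (hγa.pow _) (one_le_pow₀ hγ.le) (by simpa using pow_le_pow_right₀ hγ.le k.le_succ)
      r r₁ r₂ hrd hr₁d hr₂d hr hr₁i' hr₂i'
    rw [toric_mk_eq_add_of_sub_sub_mem hcut]
    -- the lower piece by induction
    have h₁ : (QuotientAddGroup.mk' KZ.relations) (KZ.of r₁) = k • (QuotientAddGroup.mk' KZ.relations) (KZ.of u) := by
      refine ih r₁ ?_ hr₁i'
      rw [hr₁d, Function.update_idem]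
    -- the upper piece by the scaling x_m ↦ γ^{-k} x_m
    set l : Fin n → ℝ := Function.update (fun _ => (1:ℝ)) m ((γ ^ k)⁻¹) with hl
    have hlp : ∀ j, 0 < l j := toric_update_pos h1p m (inv_pos.mpr hγk0)
    have hla : ∀ j, IsAlgebraic ℚ (l j) := toric_update_algebraic h1a m (hγa.pow _).inv
    obtain ⟨u', hu'd, hu'i⟩ := hEx n (fun j => l j * Function.update (fun _ => (1:ℝ)) m (γ ^ k) j)
      (fun j => l j * Function.update c m (γ ^ (k + 1)) j)
      (fun j => mul_pos (hlp j) (toric_update_pos h1p m hγk0 j))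
      (fun j => (hla j).mul (toric_update_algebraic h1a m (hγa.pow _) j))
      (fun j => (hla j).mul (toric_update_algebraic hca m (hγa.pow _) j))
    have hu'i' : ∀ x ∈ u'.domain, u'.integrand x = 1 := fun x _ => by rw [hu'i]
    have hsc := hScale n (Function.update (fun _ => (1:ℝ)) m (γ ^ k))
      (Function.update c m (γ ^ (k + 1))) l hlp hla r₂ u' hr₂d hu'd hr₂i' hu'i'
    have h₂ : (QuotientAddGroup.mk' KZ.relations) (KZ.of r₂) = (QuotientAddGroup.mk' KZ.relations) (KZ.of u') := toric_mk_eq_iff.mpr hsc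
    -- u' and u have the same domain
    have hla1 : ∀ j, l j * Function.update (fun _ => (1:ℝ)) m (γ ^ k) j = 1 := by
      intro j
      rcases eq_or_ne j m with rfl | h
      · simp [hl, hγk0.ne']
      · simp [hl, Function.update_of_ne h]
    have hlc : ∀ j, l j * Function.update c m (γ ^ (k + 1)) j = Function.update c m γ j := by
      intro j
      rcases eq_or_ne j m with rfl | h
      · simp [hl, pow_succ, hγk0.ne']
      · simp [hl, Function.update_of_ne h]
    have h₃ : (QuotientAddGroup.mk' KZ.relations) (KZ.of u') = (QuotientAddGroup.mk' KZ.relations) (KZ.of u) := by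
      refine toric_mk_eq_of_domain_eq ?_ hu'i' hu
      rw [hu'd, hud]
      ext p
      simp only [mem_setOf_eq, hla1, hlc]
    rw [h₁, h₂, h₃, succ_nsmul]

/-! ## Packaged moves on log-boxes -/

/-- **Rescaling, packaged.** A representation on the log-box over `(a, b)` has the same class as
any integrand-`1` representation on the log-box over `(a', b')` whenever `a' = l • a`,
`b' = l • b` for a positive real-algebraic vector `l` (one diagonal scaling, rule 2).
[folklore] -/
theorem toric_rescale (hEx : (∀ (n : ℕ) (a b : Fin n → ℝ), (∀ j, 0 < a j) → (∀ j, IsAlgebraic ℚ (a j)) → (∀ j, IsAlgebraic ℚ (b j)) → ∃ r : KZ.IntegralRep (n + 1), r.domain = {p : Fin (n + 1) → ℝ | (∀ j : Fin n, a j < p (Fin.castSucc j) ∧ p (Fin.castSucc j) < b j) ∧ 0 < p (Fin.last n) ∧ p (Fin.last n) * ∏ j : Fin n, p (Fin.castSucc j) < 1} ∧ r.integrand = fun _ => 1)) (hScale : (∀ (n : ℕ) (a b l : Fin n → ℝ), (∀ j, 0 < l j) → (∀ j, IsAlgebraic ℚ (l j)) → ∀ (r r' : KZ.IntegralRep (n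 + 1)), r.domain = {p : Fin (n + 1) → ℝ | (∀ j : Fin n, a j < p (Fin.castSucc j) ∧ p (Fin.castSucc j) < b j) ∧ 0 < p (Fin.last n) ∧ p (Fin.last n) * ∏ j : Fin n, p (Fin.castSucc j) < 1} → r'.domain = {p : Fin (n + 1) → ℝ | (∀ j : Fin n, l j * a j < p (Fin.castSucc j) ∧ p (Fin.castSucc j) < l j * b j) ∧ 0 < p (Fin.last n) ∧ p (Fin.last n) * ∏ j : Fin n, p (Fin.castSucc j) < 1} → (∀ p ∈ r.domain, r.integrand p = 1) → (∀ p ∈ r'.domain, r'.integrand p = 1) → KZ.of r - KZ.of r' ∈ KZ.relations)) {n : ℕ} {a b : Fin n → ℝ}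
    (l : Fin n → ℝ) (hlp : ∀ j, 0 < l j) (hla : ∀ j, IsAlgebraic ℚ (l j))
    (ha : ∀ j, 0 < a j) (haa : ∀ j, IsAlgebraic ℚ (a j)) (hba : ∀ j, IsAlgebraic ℚ (b j))
    (r : KZ.IntegralRep (n + 1)) (hrd : r.domain = {p : Fin (n + 1) → ℝ | (∀ j : Fin n, a j < p (Fin.castSucc j) ∧ p (Fin.castSucc j) < b j) ∧ 0 < p (Fin.last n) ∧ p (Fin.last n) * ∏ j : Fin n, p (Fin.castSucc j) < 1})
    (hr : ∀ x ∈ r.domain, r.integrand x = 1) {a' b' : Fin n → ℝ}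
    (ha' : ∀ j, l j * a j = a' j) (hb' : ∀ j, l j * b j = b' j)
    (u : KZ.IntegralRep (n + 1)) (hud : u.domain = {p : Fin (n + 1) → ℝ | (∀ j : Fin n, a' j < p (Fin.castSucc j) ∧ p (Fin.castSucc j) < b' j) ∧ 0 < p (Fin.last n) ∧ p (Fin.last n) * ∏ j : Fin n, p (Fin.castSucc j) < 1})
    (hu : ∀ x ∈ u.domain, u.integrand x = 1) : (QuotientAddGroup.mk' KZ.relations) (KZ.of r) = (QuotientAddGroup.mk' KZ.relations) (KZ.of u) := by
  obtain ⟨u', hu'd, hu'i⟩ := hEx n (fun j => l j * a j) (fun j => l j * b j)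
    (fun j => mul_pos (hlp j) (ha j)) (fun j => (hla j).mul (haa j)) (fun j => (hla j).mul (hba j))
  have hu'i' : ∀ x ∈ u'.domain, u'.integrand x = 1 := fun x _ => by rw [hu'i]
  have hsc := hScale n a b l hlp hla r u' hrd hu'd hr hu'i'
  rw [toric_mk_eq_iff.mpr hsc]
  refine toric_mk_eq_of_domain_eq ?_ hu'i' hu
  rw [hu'd, hud]
  ext p
  simp only [mem_setOf_eq, ha', hb']

/-- **Cutting, packaged.** A representation on the log-box over `(a, b)` splits, in the quotient,
as the sum of integrand-`1` representations on the two log-boxes cut out by the binomial wall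
`x_m = x` (`a_m ≤ x ≤ b_m`, `x` real algebraic); the pieces exist by `HExists`. [folklore] -/
theorem toric_cut (hEx : (∀ (n : ℕ) (a b : Fin n → ℝ), (∀ j, 0 < a j) → (∀ j, IsAlgebraic ℚ (a j)) → (∀ j, IsAlgebraic ℚ (b j)) → ∃ r : KZ.IntegralRep (n + 1), r.domain = {p : Fin (n + 1) → ℝ | (∀ j : Fin n, a j < p (Fin.castSucc j) ∧ p (Fin.castSucc j) < b j) ∧ 0 < p (Fin.last n) ∧ p (Fin.last n) * ∏ j : Fin n, p (Fin.castSucc j) < 1} ∧ r.integrand = fun _ => 1)) (hCut : (∀ (n : ℕ) (a b : Fin n → ℝ) (j : Fin n) (c : ℝ), IsAlgebraic ℚ c → a j ≤ c → c ≤ b j → ∀ (r r₁ r₂ : KZ.IntegralRep (n + 1)), r.domain = {p : Fin (n + 1) → ℝ | (∀ j : Fin n, a j < p (Fin.castSucc j) ∧ p (Fin.castSucc j) < b j) ∧ 0 < p (Fin.last n) ∧ p (Fin.last n) * ∏ j : Fin n, p (Fin.castSucc j) < 1} → r₁.domain = {p : Fin (n + 1) → ℝ | (∀ i : Fin n, a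 i < p (Fin.castSucc i) ∧ p (Fin.castSucc i) < Function.update b j c i) ∧ 0 < p (Fin.last n) ∧ p (Fin.last n) * ∏ i : Fin n, p (Fin.castSucc i) < 1} → r₂.domain = {p : Fin (n + 1) → ℝ | (∀ i : Fin n, Function.update a j c i < p (Fin.castSucc i) ∧ p (Fin.castSucc i) < b i) ∧ 0 < p (Fin.last n) ∧ p (Fin.last n) * ∏ i : Fin n, p (Fin.castSucc i) < 1} → (∀ p ∈ r.domain, r.integrand p = 1) → (∀ p ∈ r₁.domain, r₁.integrand p = 1) → (∀ p ∈ r₂.domain, r₂.integrand p = 1) → KZ.of r - KZ.of r₁ - KZ.of r₂ ∈ KZ.relations)) {n : ℕ} {a b : Fin n → ℝ}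
    (ha : ∀ j, 0 < a j) (haa : ∀ j, IsAlgebraic ℚ (a j)) (hba : ∀ j, IsAlgebraic ℚ (b j))
    (m : Fin n) {x : ℝ} (hxa : IsAlgebraic ℚ x) (h₁ : a m ≤ x) (h₂ : x ≤ b m)
    (r : KZ.IntegralRep (n + 1)) (hrd : r.domain = {p : Fin (n + 1) → ℝ | (∀ j : Fin n, a j < p (Fin.castSucc j) ∧ p (Fin.castSucc j) < b j) ∧ 0 < p (Fin.last n) ∧ p (Fin.last n) * ∏ j : Fin n, p (Fin.castSucc j) < 1})
    (hr : ∀ p ∈ r.domain, r.integrand p = 1) :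
    ∃ r₁ r₂ : KZ.IntegralRep (n + 1),
      r₁.domain = {p : Fin (n + 1) → ℝ | (∀ j : Fin n, a j < p (Fin.castSucc j) ∧ p (Fin.castSucc j) < (Function.update b m x) j) ∧ 0 < p (Fin.last n) ∧ p (Fin.last n) * ∏ j : Fin n, p (Fin.castSucc j) < 1} ∧ (∀ p ∈ r₁.domain, r₁.integrand p = 1) ∧
      r₂.domain = {p : Fin (n + 1) → ℝ | (∀ j : Fin n, (Function.update a m x) j < p (Fin.castSucc j) ∧ p (Fin.castSucc j) < b j) ∧ 0 < p (Fin.last n) ∧ p (Fin.last n) * ∏ j : Fin n, p (Fin.castSucc j) < 1} ∧ (∀ p ∈ r₂.domain, r₂.integrand p = 1) ∧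
      (QuotientAddGroup.mk' KZ.relations) (KZ.of r) = (QuotientAddGroup.mk' KZ.relations) (KZ.of r₁) + (QuotientAddGroup.mk' KZ.relations) (KZ.of r₂) := by
  have hx : 0 < x := (ha m).trans_le h₁
  obtain ⟨r₁, hr₁d, hr₁i⟩ := hEx n a (Function.update b m x) ha haa
    (toric_update_algebraic hba m hxa)
  obtain ⟨r₂, hr₂d, hr₂i⟩ := hEx n (Function.update a m x) b (toric_update_pos ha m hx)
    (toric_update_algebraic haa m hxa) hba
  have hr₁i' : ∀ p ∈ r₁.domain, r₁.integrand p = 1 := fun p _ => by rw [hr₁i]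
  have hr₂i' : ∀ p ∈ r₂.domain, r₂.integrand p = 1 := fun p _ => by rw [hr₂i]
  exact ⟨r₁, r₂, hr₁d, hr₁i', hr₂d, hr₂i', toric_mk_eq_add_of_sub_sub_mem
    (hCut n a b m x hxa h₁ h₂ r r₁ r₂ hrd hr₁d hr₂d hr hr₁i' hr₂i')⟩

/-- Products of one-point updates of the constant vector `1` (scaling bookkeeping). [folklore] -/
theorem toric_update_one_mul_update {n : ℕ} (m : Fin n) (c : Fin n → ℝ) (x y : ℝ) :
    ∀ j, Function.update (fun _ => (1 : ℝ)) m x j * Function.update c m y j =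
      Function.update c m (x * y) j := by
  intro j
  rcases eq_or_ne j m with rfl | h
  · simp
  · simp [Function.update_of_ne h]

/-- Products of one-point updates of the constant vector `1`, both factors updates of `1`.
[folklore] -/
theorem toric_update_one_mul_update_one {n : ℕ} (m : Fin n) (x y : ℝ) (hxy : x * y = 1) :
    ∀ j, Function.update (fun _ => (1 : ℝ)) m x j * Function.update (fun _ => (1 : ℝ)) m y j =
      (fun _ => (1 : ℝ)) j := by
  intro j
  rw [toric_update_one_mul_update m (fun _ => (1 : ℝ)) x y j, hxy]
  rcases eq_or_ne j m with rfl | h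
  · simp
  · simp [Function.update_of_ne h]

end Summit.KontsevichZagierPeriods.SymplecticScissors.LogPolytope

end
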